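import Literature.Analysis.FluidPDE.TaoCascadeBlowupDynamicsWith
import HarnessLib

/-!
# Tao's cascade ODE: the corrected Props. 6.3/6.4 are equivalent to Thm. 6.2

T. Tao, *Finite time blowup for an averaged three-dimensional Navier–Stokes equation*,
J. Amer. Math. Soc. 29 (2016), 601–674 = arXiv:1402.0290v3, §6.2–6.3.

`TaoCascadeBlowupDynamicsWith.lean` records that the *printed* Props. 6.3/6.4
(`blowupDynamics`, `blowupDynamicsStep`), being stated under the contradiction hypothesis of
Thm. 6.2 ("suppose for contradiction that we may find … `X_{i,n}`, `E_n` with the stated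
properties"), are equivalent to Thm. 6.2 (`noGlobalODESolution`), and that the versions with any
coefficient `γ ≥ 0` in (6.17)/(6.32) imply Thm. 6.2. This file adds the (vacuous) converse for
every `γ`, whence the named facts `blowupDynamicsStepCorrected` and `blowupDynamicsCorrected`
(the author-corrected Props. 6.4/6.3) are each **equivalent** to `noGlobalODESolution`: a proof
of any one of Thm. 6.2, Prop. 6.3, Prop. 6.4 (printed or corrected) — or of the corrected
rescaled step `rescaledStepCorrected'` of `TaoCascadeRescaledStepOrder.lean`, via
`noGlobalODESolution_of_rescaledStepCorrected'` — discharges all of them.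

## References

* T. Tao, J. Amer. Math. Soc. 29 (2016), 601–674 = arXiv:1402.0290v3, §6.2 Prop. 6.3 and p. 53,
  §6.3 Prop. 6.4. [`Tao2016AveragedNS`]
-/

noncomputable section

namespace Literature.Analysis.FluidPDE

namespace TaoCascade

/-- Being stated under the contradiction hypothesis of Thm. 6.2, Prop. 6.4 with *any* coefficient
`γ` follows from Thm. 6.2 vacuously (same argument as `blowupDynamicsStep_of_noGlobalODESolution`).
[cite: Tao2016AveragedNS, §6.3 Prop. 6.4] -/
theorem blowupDynamicsStepWith_of_noGlobalODESolution {γ : ℝ → ℝ} (h : noGlobalODESolution) :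
    blowupDynamicsStepWith γ := by
  intro ε₀ hε₀ hε₀1
  obtain ⟨K₀, hK⟩ := h ε₀ hε₀ hε₀1
  refine ⟨K₀, fun K hK₀K hKpos => ?_⟩
  obtain ⟨e₀, he₀, hε⟩ := hK K hK₀K hKpos
  refine ⟨e₀, he₀, fun ε hεpos hεle C₁ C₂ hC₁ hC₂ => ?_⟩
  obtain ⟨N₀, hN⟩ := hε ε hεpos hεle C₁ C₂ hC₁ hC₂
  exact ⟨N₀, fun n₀ hn₀ X E hsol => absurd ⟨X, E, hsol⟩ (hN n₀ hn₀)⟩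

/-- Likewise Prop. 6.3 with any coefficient `γ` follows from Thm. 6.2 vacuously.
[cite: Tao2016AveragedNS, §6.2 Prop. 6.3] -/
theorem blowupDynamicsWith_of_noGlobalODESolution {γ : ℝ → ℝ} (h : noGlobalODESolution) :
    blowupDynamicsWith γ := by
  intro ε₀ hε₀ hε₀1
  obtain ⟨K₀, hK⟩ := h ε₀ hε₀ hε₀1
  refine ⟨K₀, fun K hK₀K hKpos => ?_⟩
  obtain ⟨e₀, he₀, hε⟩ := hK K hK₀K hKpos
  refine ⟨e₀, he₀, fun ε hεpos hεle C₁ C₂ hC₁ hC₂ => ?_⟩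
  obtain ⟨N₀, hN⟩ := hε ε hεpos hεle C₁ C₂ hC₁ hC₂
  exact ⟨N₀, fun n₀ hn₀ X E hsol => absurd ⟨X, E, hsol⟩ (hN n₀ hn₀)⟩

/-- For `γ ≥ 0`, Prop. 6.4 with coefficient `γ` ⟺ Thm. 6.2. [cite: Tao2016AveragedNS, §6.2–6.3] -/
theorem blowupDynamicsStepWith_iff_noGlobalODESolution {γ : ℝ → ℝ} (hγ : ∀ K, 0 < K → 0 ≤ γ K) :
    blowupDynamicsStepWith γ ↔ noGlobalODESolution :=
  ⟨noGlobalODESolution_of_blowupDynamicsStepWith hγ, blowupDynamicsStepWith_of_noGlobalODESolution⟩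

/-- For any `γ`, Prop. 6.3 with coefficient `γ` ⟺ Thm. 6.2. [cite: Tao2016AveragedNS, §6.2] -/
theorem blowupDynamicsWith_iff_noGlobalODESolution {γ : ℝ → ℝ} :
    blowupDynamicsWith γ ↔ noGlobalODESolution :=
  ⟨noGlobalODESolution_of_blowupDynamicsWith, blowupDynamicsWith_of_noGlobalODESolution⟩

/-- **The corrected Prop. 6.4 ⟺ Thm. 6.2**: `blowupDynamicsStepCorrected` is discharged by any
proof of `noGlobalODESolution`, and conversely. [cite: Tao2016AveragedNS, §6.2–6.3] -/
theorem blowupDynamicsStepCorrected_iff_noGlobalODESolution :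
    blowupDynamicsStepCorrected ↔ noGlobalODESolution :=
  blowupDynamicsStepWith_iff_noGlobalODESolution fun K _ => by positivity

/-- **The corrected Prop. 6.3 ⟺ Thm. 6.2.** [cite: Tao2016AveragedNS, §6.2] -/
theorem blowupDynamicsCorrected_iff_noGlobalODESolution :
    blowupDynamicsCorrected ↔ noGlobalODESolution :=
  blowupDynamicsWith_iff_noGlobalODESolution

/-- The corrected Prop. 6.4 implies the corrected Prop. 6.3 (the induction of §6.3 with
coefficient `10⁻⁵ exp(-K¹⁰/2) ≥ 0`). [cite: Tao2016AveragedNS, §6.3] -/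
theorem blowupDynamicsCorrected_of_stepCorrected (h : blowupDynamicsStepCorrected) :
    blowupDynamicsCorrected :=
  blowupDynamicsWith_of_blowupDynamicsStepWith (fun K _ => by positivity) h

end TaoCascade

end Literature.Analysis.FluidPDE
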